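import Summits.AtomisticToContinuum.Crystallization.Theorems.ChartedZeroExcessLayeredLatticeLiouvilleZZZYRCZN
import Summits.AtomisticToContinuum.Crystallization.Theorems.ChartedZeroExcessLayeredLatticeLiouvilleZZZYRCZO

/-!
# Charted zero-excess layered-lattice Liouville — ZZZYRCZT: the R3-W ATLAS DOOR `uniformEquilStabilityAt_of_atlasW` (r1867 (R8)) and the
coverage reduction to SHAPE cells

Cell `decomp-a2c`, lens 2, generation 100.  ZZZYRCZN proved the atlas door for an arbitrary labelling class `Can` and box family `InBox`.  Under the
repair of record for «APERIODIC-COVER» (r1864 (A)(2) option (i); census «WINSPLIT57»; r1867) the atlas is indexed by SHAPE cells only — scale window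
`[aLo, aHi]`, slip bound `τ`, height window `[hLo, hHi]` — and a configuration is in a cell when SOME letter sequence `ℓ : ℤ → {0,1,2}` puts it in
the slab box of ZZZYRCZO with those dials (`InBoxW`); the letter windows, their 272 orbit types at `H₀ = 5` and the letter-free remainder live INSIDE
the per-cell obligations (hand-1's windowed kernel RCXR + the K-file), bond by bond.  This file:

§1 `InBoxW s aLo aHi τ hLo hHi L w' := ∃ ℓ, IsLetterSeq ℓ ∧ SlabBoxF ℓ aLo aHi s τ hLo hHi L w'` and ★★ `uniformEquilStabilityAt_of_atlasW` = ZZZYRCZN's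
   `uniformEquilStabilityAt_of_atlasC` at `Can := IsRegisteredWordB δ hLoB hHiB` (below) and `InBox i := InBoxW s (aLo i) (aHi i) (τ i) (hLo i) (hHi i)`;
§1b (r1870 (B3)(iii)) the GENERIC cell `SlabBoxG ℓ aLo aHi s τ hLo hHi m₀` with a height-bracket FAMILY `hLo hHi : ℤ → ℝ` indexed by the layer
   offset from the centre layer `m₀`, `InBoxWG`; the constant family IS `SlabBoxF`/`InBoxW` (`Iff.rfl`), so (h1) = constant band, (h2′) = linearly
   widening family and any (h3) instantiate one object; `slabBoxF_of_slabBoxG` (uniform envelope) feeds today's global comparison lemmas;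
§2 THE BANDED REGISTERED CLASS `IsRegisteredWordB δ hLoB hHiB a L w'` := `IsRegisteredWord δ` with the heights pinned to a band `hLoB·a ≤ h m ≤ hHiB·a`
   for EVERY layer (the CELL-ID content «HBAND»: clean + hollow registry ⇒ each interlayer height lies in the clean band, layer by layer; it is owed in
   `UniformReindexPC … (IsRegisteredWordB δ hLoB hHiB)`, next to the hollow-stacking lemma), `isRegisteredWord_of_banded`, monotonicity;
§3 ★ `atlasCoversPC_of_shapeCoverW`: (ABAND `ScaleBandP`: admissible ⇒ `amin ≤ a ≤ amax`) → (the cells cover `[amin, amax]` in scale, each with `δ ≤ τ i`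
   and height window ⊇ the band) → `AtlasCoversPC s Λ c₀ ℓ₀ (IsRegisteredWordB δ hLoB hHiB) InBoxW…` — JSBOX-SOUND on the Lean side reduces to an interval
   cover of the scale range by finitely many cells (a `decide`/`norm_num` check per atlas) once the h-cells are H-BAND cells (planner flag «H-PROFILE»,
   memo §13: a cell pinning ALL layers' heights to a window narrower than the band covers no configuration whose height profile straddles two cells).
-/

namespace Summit.AtomisticToContinuum.Crystallization.Theorems.ChartedZeroExcessLayeredLatticeLiouville

open scoped RealInnerProductSpace
open Summit.AtomisticToContinuum.Crystallization.Theorems.ChartedPlanarOrderRigidityDoor (E3)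

variable {ι : Type*}

/-! ### §1 shape cells and the door -/

/-- ★ IN A SHAPE CELL: some letter sequence puts `(L, w')` in the slab box with dials `(aLo, aHi, τ, hLo, hHi)` at conformal defect `s`. [g100] -/
def InBoxW (s aLo aHi τ hLo hHi : ℝ) (L : E3 ≃L[ℝ] E3) (w' : ℤ → E3) : Prop :=
  ∃ ℓ : ℤ → ℤ, IsLetterSeq ℓ ∧ SlabBoxF ℓ aLo aHi s τ hLo hHi L w'

/-! ### §1b GENERIC shape cells: a HEIGHT-BRACKET FAMILY indexed by the layer offset from a centre layer (r1870 (B3)(iii)) -/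

/-- ★ THE SLAB BOX WITH A HEIGHT-BRACKET FAMILY centred at layer `m₀`: `SlabBoxF` with the height clause replaced by
`hLo (m − m₀)·a ≤ h m ≤ hHi (m − m₀)·a` — the constant family is today's cell (option (h1) = the band as the constant), a linearly widening family
`hLo d = ρLo − |d|·ω_h`, `hHi d = ρHi + |d|·ω_h` is the windowed h-cell licensed by a profile-Lipschitz lemma «HPROF-LIP» (option (h2′)). [g100] -/
def SlabBoxG (ℓ : ℤ → ℤ) (aLo aHi s τ : ℝ) (hLo hHi : ℤ → ℝ) (m₀ : ℤ) (L : E3 ≃L[ℝ] E3) (w : ℤ → E3) : Prop :=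
  ∃ (a : ℝ) (n : E3) (r : ℤ → E3) (h : ℤ → ℝ), aLo ≤ a ∧ a ≤ aHi ∧ IsConfChart a s (L : E3 →L[ℝ] E3) ∧ ‖n‖ = 1 ∧
    ⟪gen₁ L, n⟫ = 0 ∧ ⟪gen₂ L, n⟫ = 0 ∧ (∀ m, ‖r m‖ ≤ τ * a) ∧ (∀ m, hLo (m - m₀) * a ≤ h m ∧ h m ≤ hHi (m - m₀) * a) ∧
    (∀ m, ⟪r m, n⟫ = 0) ∧
    ∀ m : ℤ, w (m + 1) - w m = (((ℓ (m + 1) : ℝ) - ℓ m) / 3) • (gen₁ L + gen₂ L) + r m + h m • n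

/-- the CONSTANT family is `SlabBoxF` on the nose. [g100] -/
theorem slabBoxG_const (ℓ : ℤ → ℤ) (aLo aHi s τ hLo hHi : ℝ) (m₀ : ℤ) (L : E3 ≃L[ℝ] E3) (w : ℤ → E3) :
    SlabBoxG ℓ aLo aHi s τ (fun _ => hLo) (fun _ => hHi) m₀ L w ↔ SlabBoxF ℓ aLo aHi s τ hLo hHi L w := Iff.rfl

/-- monotonicity in the bracket family (pointwise wider brackets). [g100] -/
theorem slabBoxG_mono {ℓ : ℤ → ℤ} {aLo aHi s τ : ℝ} {hLo hHi hLo' hHi' : ℤ → ℝ} {m₀ : ℤ} {L : E3 ≃L[ℝ] E3} {w : ℤ → E3} (ha : 0 ≤ aLo)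
    (hlo : ∀ d, hLo' d ≤ hLo d) (hhi : ∀ d, hHi d ≤ hHi' d) (hB : SlabBoxG ℓ aLo aHi s τ hLo hHi m₀ L w) :
    SlabBoxG ℓ aLo aHi s τ hLo' hHi' m₀ L w := by
  obtain ⟨a, n, r, h, haLo, haHi, hconf, hn, hg₁, hg₂, hr, hh, hrn, hstep⟩ := hB
  have ha' : 0 ≤ a := ha.trans haLo
  exact ⟨a, n, r, h, haLo, haHi, hconf, hn, hg₁, hg₂, hr, fun m => ⟨(mul_le_mul_of_nonneg_right (hlo _) ha').trans (hh m).1,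
    (hh m).2.trans (mul_le_mul_of_nonneg_right (hhi _) ha')⟩, hrn, hstep⟩

/-- a UNIFORM ENVELOPE of the family gives today's cell: every global comparison lemma of ZZZYRCZO/ZZZYRCZP applies to a bracket-family box with
the envelope `[inf hLo, sup hHi]` as its h-cell. [g100] -/
theorem slabBoxF_of_slabBoxG {ℓ : ℤ → ℤ} {aLo aHi s τ hLo' hHi' : ℝ} {hLo hHi : ℤ → ℝ} {m₀ : ℤ} {L : E3 ≃L[ℝ] E3} {w : ℤ → E3} (ha : 0 ≤ aLo)
    (hlo : ∀ d, hLo' ≤ hLo d) (hhi : ∀ d, hHi d ≤ hHi') (hB : SlabBoxG ℓ aLo aHi s τ hLo hHi m₀ L w) : SlabBoxF ℓ aLo aHi s τ hLo' hHi' L w :=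
  (slabBoxG_const ℓ aLo aHi s τ hLo' hHi' m₀ L w).1 (slabBoxG_mono ha hlo hhi hB)

/-- ★ IN A GENERIC SHAPE CELL centred at layer `m₀`: some letter sequence puts `(L, w')` in the bracket-family slab box. [g100] -/
def InBoxWG (s aLo aHi τ : ℝ) (hLo hHi : ℤ → ℝ) (m₀ : ℤ) (L : E3 ≃L[ℝ] E3) (w' : ℤ → E3) : Prop :=
  ∃ ℓ : ℤ → ℤ, IsLetterSeq ℓ ∧ SlabBoxG ℓ aLo aHi s τ hLo hHi m₀ L w'

/-- the constant family is `InBoxW`. [g100] -/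
theorem inBoxWG_const (s aLo aHi τ hLo hHi : ℝ) (m₀ : ℤ) (L : E3 ≃L[ℝ] E3) (w' : ℤ → E3) :
    InBoxWG s aLo aHi τ (fun _ => hLo) (fun _ => hHi) m₀ L w' ↔ InBoxW s aLo aHi τ hLo hHi L w' := Iff.rfl

/-- a generic cell with uniform envelope lies in the constant cell of the envelope. [g100] -/
theorem inBoxW_of_inBoxWG {s aLo aHi τ hLo' hHi' : ℝ} {hLo hHi : ℤ → ℝ} {m₀ : ℤ} {L : E3 ≃L[ℝ] E3} {w' : ℤ → E3} (ha : 0 ≤ aLo)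
    (hlo : ∀ d, hLo' ≤ hLo d) (hhi : ∀ d, hHi d ≤ hHi') (hB : InBoxWG s aLo aHi τ hLo hHi m₀ L w') : InBoxW s aLo aHi τ hLo' hHi' L w' := by
  obtain ⟨ℓ, hℓ, hbox⟩ := hB
  exact ⟨ℓ, hℓ, slabBoxF_of_slabBoxG ha hlo hhi hbox⟩

/-! ### §2 the banded registered class -/

/-- **«IsRegisteredWordB δ hLoB hHiB a L w'»** — the registered labelling of record (ZZZYRCZN `IsRegisteredWord δ`) with every interlayer height in
the band `[hLoB·a, hHiB·a]` (letters in `{0,1,2}`, unit normal of the chart plane, slips `‖r m‖ ≤ δ·a` ⊥ n). [g100] -/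
def IsRegisteredWordB (δ hLoB hHiB a : ℝ) (L : E3 ≃L[ℝ] E3) (w' : ℤ → E3) : Prop :=
  ∃ (ℓ : ℤ → ℤ) (n : E3) (r : ℤ → E3) (h : ℤ → ℝ), IsLetterSeq ℓ ∧ ‖n‖ = 1 ∧ ⟪gen₁ L, n⟫ = 0 ∧ ⟪gen₂ L, n⟫ = 0 ∧
    (∀ m, ‖r m‖ ≤ δ * a ∧ ⟪r m, n⟫ = 0 ∧ hLoB * a ≤ h m ∧ h m ≤ hHiB * a) ∧
    ∀ m : ℤ, w' (m + 1) - w' m = (((ℓ (m + 1) : ℝ) - ℓ m) / 3) • (gen₁ L + gen₂ L) + r m + h m • n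

/-- a banded registered word with a positive band floor is registered. [g100] -/
theorem isRegisteredWord_of_banded {δ hLoB hHiB a : ℝ} {L : E3 ≃L[ℝ] E3} {w' : ℤ → E3} (hlo : 0 < hLoB * a)
    (h : IsRegisteredWordB δ hLoB hHiB a L w') : IsRegisteredWord δ a L w' := by
  obtain ⟨ℓ, n, r, hh, hℓ, hn, hg₁, hg₂, hrh, hstep⟩ := h
  exact ⟨ℓ, n, r, hh, hℓ, hn, hg₁, hg₂, fun m => ⟨(hrh m).1, (hrh m).2.1, hlo.trans_le (hrh m).2.2.1⟩, hstep⟩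

/-- the banded class is monotone in the slip bound and the band. [g100] -/
theorem isRegisteredWordB_mono {δ δ' hLoB hHiB hLoB' hHiB' a : ℝ} {L : E3 ≃L[ℝ] E3} {w' : ℤ → E3} (ha : 0 ≤ a) (hδ : δ ≤ δ') (hlo : hLoB' ≤ hLoB)
    (hhi : hHiB ≤ hHiB') (h : IsRegisteredWordB δ hLoB hHiB a L w') : IsRegisteredWordB δ' hLoB' hHiB' a L w' := by
  obtain ⟨ℓ, n, r, hh, hℓ, hn, hg₁, hg₂, hrh, hstep⟩ := h
  refine ⟨ℓ, n, r, hh, hℓ, hn, hg₁, hg₂, fun m => ⟨?_, (hrh m).2.1, ?_, ?_⟩, hstep⟩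
  · exact (hrh m).1.trans (mul_le_mul_of_nonneg_right hδ ha)
  · exact (mul_le_mul_of_nonneg_right hlo ha).trans (hrh m).2.2.1
  · exact (hrh m).2.2.2.trans (mul_le_mul_of_nonneg_right hhi ha)

/-- a banded registered admissible word lies in every shape cell whose dials contain its scale, slip bound and band. [g100] -/
theorem inBoxW_of_registeredB {s Λ c₀ ℓ₀ δ hLoB hHiB a aLo aHi τ hLo hHi : ℝ} {L : E3 ≃L[ℝ] E3} {w' : ℤ → E3} (ha : 0 ≤ a)
    (hA : IsAdmissibleWord a s Λ c₀ ℓ₀ L w') (hreg : IsRegisteredWordB δ hLoB hHiB a L w') (haLo : aLo ≤ a) (haHi : a ≤ aHi) (hτ : δ ≤ τ)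
    (hlo : hLo ≤ hLoB) (hhi : hHiB ≤ hHi) : InBoxW s aLo aHi τ hLo hHi L w' := by
  obtain ⟨ℓ, n, r, hh, hℓ, hn, hg₁, hg₂, hrh, hstep⟩ := isRegisteredWordB_mono ha hτ hlo hhi hreg
  exact ⟨ℓ, hℓ, a, n, r, hh, haLo, haHi, hA.2.2.1, hn, hg₁, hg₂, fun m => (hrh m).1, fun m => (hrh m).2.2, fun m => (hrh m).2.1, hstep⟩

/-! ### §3 coverage from a scale cover by H-band cells -/

/-- **(ABAND) «ScaleBandP s Λ c₀ ℓ₀ amin amax»** — the scale of an admissible word lies in `[amin, amax]` (CELL-ID family: the clean first shell and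
the `s`-conformal chart pin the in-plane lattice constant; support). [g100] -/
def ScaleBandP (s Λ c₀ ℓ₀ amin amax : ℝ) : Prop :=
  ∀ a : ℝ, 0 < a → ∀ (L : E3 ≃L[ℝ] E3) (w' : ℤ → E3), IsAdmissibleWord a s Λ c₀ ℓ₀ L w' → amin ≤ a ∧ a ≤ amax

/-- ★ **JSBOX-SOUND, Lean side**: if the cells cover the admissible scale range — every `a ∈ [amin, amax]` has a cell `i` with `aLo i ≤ a ≤ aHi i`,
slip dial `δ ≤ τ i` and height window `[hLo i, hHi i] ⊇ [hLoB, hHiB]` (H-BAND cells) — then the atlas covers the banded registered class. [g100] -/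
theorem atlasCoversPC_of_shapeCoverW {s Λ c₀ ℓ₀ δ hLoB hHiB amin amax : ℝ} {aLo aHi τ hLo hHi : ι → ℝ}
    (hband : ScaleBandP s Λ c₀ ℓ₀ amin amax)
    (hcover : ∀ a : ℝ, amin ≤ a → a ≤ amax → ∃ i, aLo i ≤ a ∧ a ≤ aHi i ∧ δ ≤ τ i ∧ hLo i ≤ hLoB ∧ hHiB ≤ hHi i) :
    AtlasCoversPC s Λ c₀ ℓ₀ (IsRegisteredWordB δ hLoB hHiB) fun i => InBoxW s (aLo i) (aHi i) (τ i) (hLo i) (hHi i) := by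
  intro a ha L w' hA hreg
  obtain ⟨h₁, h₂⟩ := hband a ha L w' hA
  obtain ⟨i, haLo, haHi, hτ, hlo, hhi⟩ := hcover a h₁ h₂
  exact ⟨i, inBoxW_of_registeredB ha.le hA hreg haLo haHi hτ hlo hhi⟩

/-- ★★ **THE R3-W ATLAS DOOR (PROVED)**: ZZZYRCZN's class door at `Can := IsRegisteredWordB δ hLoB hHiB` and shape cells `InBoxW`, with coverage
DISCHARGED by the scale cover of §3 — what remains owed is (RI♯-C) into the banded registered class, (ABAND), the per-cell certificates (cell sums, tail
debit, cluster certificate: inside them the window split of r1867) and the three structural identities, exactly as in ZZZYRCZN. [g100] -/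
theorem uniformEquilStabilityAt_of_atlasW {s Λ c₀ ℓ₀ r₁ ϱ R cZ κ₁ κ₀ γT δ hLoB hHiB amin amax : ℝ} {aLo aHi τ hLo hHi c cK : ι → ℝ}
    {ΘR ΘN : ι → (E3 ≃L[ℝ] E3) → (ℤ → E3) → (Cell 2 × ℤ) × (Cell 2 × ℤ) → ℝ}
    (h0 : 0 ≤ κ₁) (hκ : κ₀ ≤ κ₁ * cZ - γT) (hRI : UniformReindexPC s Λ c₀ ℓ₀ (IsRegisteredWordB δ hLoB hHiB))
    (hcK0 : ∀ i, 0 ≤ cK i) (hcK : ∀ i, cK i * c i ≤ 1)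
    (hCS : CellSumP s Λ c₀ ℓ₀ r₁) (hNC : CellNullLagrangianP s Λ c₀ ℓ₀ r₁) (hband : ScaleBandP s Λ c₀ ℓ₀ amin amax)
    (hcover : ∀ a : ℝ, amin ≤ a → a ≤ amax → ∃ i, aLo i ≤ a ∧ a ≤ aHi i ∧ δ ≤ τ i ∧ hLo i ≤ hLoB ∧ hHiB ≤ hHi i)
    (hcell : ∀ i, BoxCellCertificateP s Λ c₀ ℓ₀ r₁ (InBoxW s (aLo i) (aHi i) (τ i) (hLo i) (hHi i)) (c i))
    (htail : ∀ i, BoxTailDebitP s Λ c₀ ℓ₀ ϱ (InBoxW s (aLo i) (aHi i) (τ i) (hLo i) (hHi i)) (ΘR i) (ΘN i) γT)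
    (hPU : PartitionIdentityFullP s Λ c₀ ℓ₀ r₁ ϱ R) (hPD : PartitionIdentityDebitP s Λ c₀ ℓ₀ ϱ R)
    (hclus : ∀ i, BoxClusterCertificateDebitP s Λ c₀ ℓ₀ r₁ ϱ R (InBoxW s (aLo i) (aHi i) (τ i) (hLo i) (hHi i)) (cK i) (ΘR i) (ΘN i) κ₁)
    (hCZ : IndexCurrencyP s Λ c₀ ℓ₀ r₁ cZ) : UniformEquilStabilityAt s Λ κ₀ c₀ :=
  uniformEquilStabilityAt_of_atlasC h0 hκ hRI hcK0 hcK hCS hNC (atlasCoversPC_of_shapeCoverW hband hcover) hcell htail hPU hPD hclus hCZ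

/-- the same door with the coverage left as a hypothesis (for atlases certified otherwise). [g100] -/
theorem uniformEquilStabilityAt_of_atlasW' {s Λ c₀ ℓ₀ r₁ ϱ R cZ κ₁ κ₀ γT δ hLoB hHiB : ℝ} {aLo aHi τ hLo hHi c cK : ι → ℝ}
    {ΘR ΘN : ι → (E3 ≃L[ℝ] E3) → (ℤ → E3) → (Cell 2 × ℤ) × (Cell 2 × ℤ) → ℝ}
    (h0 : 0 ≤ κ₁) (hκ : κ₀ ≤ κ₁ * cZ - γT) (hRI : UniformReindexPC s Λ c₀ ℓ₀ (IsRegisteredWordB δ hLoB hHiB))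
    (hcK0 : ∀ i, 0 ≤ cK i) (hcK : ∀ i, cK i * c i ≤ 1)
    (hCS : CellSumP s Λ c₀ ℓ₀ r₁) (hNC : CellNullLagrangianP s Λ c₀ ℓ₀ r₁)
    (hcov : AtlasCoversPC s Λ c₀ ℓ₀ (IsRegisteredWordB δ hLoB hHiB) fun i => InBoxW s (aLo i) (aHi i) (τ i) (hLo i) (hHi i))
    (hcell : ∀ i, BoxCellCertificateP s Λ c₀ ℓ₀ r₁ (InBoxW s (aLo i) (aHi i) (τ i) (hLo i) (hHi i)) (c i))
    (htail : ∀ i, BoxTailDebitP s Λ c₀ ℓ₀ ϱ (InBoxW s (aLo i) (aHi i) (τ i) (hLo i) (hHi i)) (ΘR i) (ΘN i) γT)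
    (hPU : PartitionIdentityFullP s Λ c₀ ℓ₀ r₁ ϱ R) (hPD : PartitionIdentityDebitP s Λ c₀ ℓ₀ ϱ R)
    (hclus : ∀ i, BoxClusterCertificateDebitP s Λ c₀ ℓ₀ r₁ ϱ R (InBoxW s (aLo i) (aHi i) (τ i) (hLo i) (hHi i)) (cK i) (ΘR i) (ΘN i) κ₁)
    (hCZ : IndexCurrencyP s Λ c₀ ℓ₀ r₁ cZ) : UniformEquilStabilityAt s Λ κ₀ c₀ :=
  uniformEquilStabilityAt_of_atlasC h0 hκ hRI hcK0 hcK hCS hNC hcov hcell htail hPU hPD hclus hCZ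

/-- what a shape cell hands to the per-cell obligations: the co-Lipschitz constant of the cell (`2c² ≤ λ²`, five checks), by ZZZYRCZO. [g100] -/
theorem isLayeredCrystal_of_inBoxW {s aLo aHi τ hLo hHi lam mu c : ℝ} {L : E3 ≃L[ℝ] E3} {w : ℤ → E3}
    (hB : InBoxW s aLo aHi τ hLo hHi L w) (hc : 0 ≤ c) (hc2 : 2 * c ^ 2 ≤ lam ^ 2) (haLo : 0 < aLo) (hs0 : 0 ≤ s) (hs1 : s < 1) (hτ : 0 ≤ τ)
    (hhLo : 0 ≤ hLo) (hhHi : 0 ≤ hHi) (hA : lam ^ 2 < (1 - s) ^ 2 * aLo ^ 2)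
    (hAC : (1 - s) ^ 2 * τ ^ 2 * aLo ^ 4 ≤ ((1 - s) ^ 2 * aLo ^ 2 - lam ^ 2) * ((τ ^ 2 + hLo ^ 2) * aLo ^ 2 - 2 / 3 * lam ^ 2))
    (hC2 : lam ^ 2 * (τ ^ 2 + 2 / 3 * (1 - s) ^ 2) ≤ hLo ^ 2 * (1 - s) ^ 2 * aLo ^ 2) (hA' : (1 + s) ^ 2 * aHi ^ 2 < mu ^ 2)
    (hAC' : (1 + s) ^ 2 * τ ^ 2 * aHi ^ 4 ≤ (mu ^ 2 - (1 + s) ^ 2 * aHi ^ 2) * (2 / 3 * mu ^ 2 - (τ ^ 2 + hHi ^ 2) * aHi ^ 2)) :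
    IsLayeredCrystal c (gen₁ L) (gen₂ L) w := by
  obtain ⟨ℓ, hℓ, hbox⟩ := hB
  exact isLayeredCrystal_of_slabBoxF hbox hℓ hc hc2 haLo hs0 hs1 hτ hhLo hhHi hA hAC hC2 hA' hAC'

/-- DOCK (a one-cell atlas): the single H-band cell `[86/100, 88/100] × (τ = 1/10) × [74/100, 89/100]` covers the scale range `[86/100, 88/100]`
for the class `IsRegisteredWordB (1/10) (74/100) (89/100)` (the `hcover` hypothesis of the door, discharged by `norm_num`). [g100] -/
example : ∀ a : ℝ, (86 / 100 : ℝ) ≤ a → a ≤ 88 / 100 → ∃ i : Fin 1,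
    (fun _ => (86 / 100 : ℝ)) i ≤ a ∧ a ≤ (fun _ => (88 / 100 : ℝ)) i ∧ (1 / 10 : ℝ) ≤ (fun _ => (1 / 10 : ℝ)) i ∧
      (fun _ => (74 / 100 : ℝ)) i ≤ (74 / 100 : ℝ) ∧ (89 / 100 : ℝ) ≤ (fun _ => (89 / 100 : ℝ)) i :=
  fun _ h₁ h₂ => ⟨0, h₁, h₂, le_rfl, le_rfl, le_rfl⟩

end Summit.AtomisticToContinuum.Crystallization.Theorems.ChartedZeroExcessLayeredLatticeLiouville
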